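import Summits.CriticalPhenomena.PercolationContinuityZ3.Theorems.PercNearOneGluingNoHeavyLowerTailSahiTopSliceDominance

/-!
# `NoHeavyLowerTail` (crux stmt-CriticalPhenomena-4575), Sahi programme: **top-slice dominance restricted to UPPER-STEP triples (COMB-M⁺,
# any factor below the cylinder value 6; in particular the sharp conjecture `2·S ≥ 7·S(top)`) already implies Kahn's Conjecture 5**

Support file (seat `prim-ineq-gen-4`, generation 12; `--supports stmt-CriticalPhenomena-4575`).  Pure proofs, no definitions, no `sorry`,
standard axioms.  Vocabulary of `…SahiGridPattern` / `…SahiTopSliceDominance` (`Pd`, `sStarD`, `PatternPos`, `liftSet`, `KahnConjecture`).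

THE MATHEMATICS.  After generation 12 the single remaining graded statement of the cube/pattern line is COMB-M⁺: top-slice dominance for
UPPER-STEP triples only (up-sets `A, B, C ⊆ [3]^{d+1}` whose level-`1` and level-`2` slices along the last axis coincide; cube: `c₂ ≥ λ·c₃`),
conjecturally with the sharp factor `λ = 7/4`, i.e. `2·sStarD A B C ≥ 7·sStarD A₂ B₂ C₂` (memo
`run/shared/lean/prim/prim-ineq-gen-4/FINDING-STEP-TRANSFER-g12.md`, conjecture (C¼); exhaustive for `d+1 ≤ 5`, no drift at `6, 7, 8`).  The tree's
reduction `kahnConjecture_of_forall_weakTopSlice` asks for dominance on ALL triples; but the cylinders `liftSet A` it actually uses ARE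
upper-step, so the restricted hypothesis suffices:
* `ind_liftSet_snoc`, `liftSet_upperStep` — cylinders are upper-step (all three slices equal);
* `patternPos_of_upperStepDominance_succ`: if `p·sStarD(top slices) ≤ q·sStarD A B C` for all upper-step up-set triples of `[3]^{d+1}`, with
  integers `p < 6q`, then `PatternPos d`;
* `patternPos_of_forall_upperStepDominance`, `kahnConjecture_of_forall_upperStepDominance`, and the two named instances
  `kahnConjecture_of_forall_combMplus` (`(p,q) = (2,1)`: COMB-M⁺, `c₂ ≥ c₃`) and `kahnConjecture_of_forall_sharpCombMplus` (`(7,2)`: (C¼), `4c₂ ≥ 7c₃`).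
Nothing here asserts the hypotheses. [this work]
-/

namespace Summit.CriticalPhenomena.PercolationContinuityZ3.Theorems.SahiGridPattern

open Finset SahiGrid3
open scoped BigOperators

variable {d : ℕ}

/-- The indicator of a cylinder at a `snoc` point only sees the initial part. [this work] -/
theorem ind_liftSet_snoc (A : Finset (Pd d)) (q : Pd d) (i : Fin 3) :
    ind (liftSet A) (Fin.snoc q i : Pd (d + 1)) = ind A q := by
  rw [ind_liftSet, Fin.init_snoc]

/-- Cylinders are upper-step (indeed all three slices agree): levels `1` and `2` of the last axis have the same slice. [this work] -/
theorem liftSet_upperStep (A : Finset (Pd d)) (q : Pd d) :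
    ind (liftSet A) (Fin.snoc q 1 : Pd (d + 1)) = ind (liftSet A) (Fin.snoc q 2 : Pd (d + 1)) := by
  rw [ind_liftSet_snoc, ind_liftSet_snoc]

/-- **Upper-step top-slice dominance one dimension up gives the pattern inequality.**  If for integers `p < 6q` every
UPPER-STEP triple of up-sets `A, B, C ⊆ [3]^{d+1}` satisfies `p·sStarD A₂ B₂ C₂ ≤ q·sStarD A B C`, then `PatternPos d`
(apply it to the cylinders over `A, B, C`: `(6q − p)·sStarD A B C ≥ 0`). [this work] -/
theorem patternPos_of_upperStepDominance_succ {p q : ℤ} (hpq : p < 6 * q)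
    (h : ∀ A B C : Finset (Pd (d + 1)), IsUpperSet (A : Set (Pd (d + 1))) → IsUpperSet (B : Set (Pd (d + 1))) →
      IsUpperSet (C : Set (Pd (d + 1))) →
      (∀ x : Pd d, ind A (Fin.snoc x 1 : Pd (d + 1)) = ind A (Fin.snoc x 2 : Pd (d + 1))) →
      (∀ x : Pd d, ind B (Fin.snoc x 1 : Pd (d + 1)) = ind B (Fin.snoc x 2 : Pd (d + 1))) →
      (∀ x : Pd d, ind C (Fin.snoc x 1 : Pd (d + 1)) = ind C (Fin.snoc x 2 : Pd (d + 1))) →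
      p * sStarD (univ.filter fun x : Pd d => (Fin.snoc x 2 : Pd (d + 1)) ∈ A)
            (univ.filter fun x : Pd d => (Fin.snoc x 2 : Pd (d + 1)) ∈ B)
            (univ.filter fun x : Pd d => (Fin.snoc x 2 : Pd (d + 1)) ∈ C) ≤ q * sStarD A B C) :
    PatternPos d := by
  intro A B C hA hB hC
  have h6 := h (liftSet A) (liftSet B) (liftSet C) (isUpperSet_liftSet hA) (isUpperSet_liftSet hB) (isUpperSet_liftSet hC)
    (liftSet_upperStep A) (liftSet_upperStep B) (liftSet_upperStep C)
  rw [filter_snoc_two_mem_liftSet, filter_snoc_two_mem_liftSet, filter_snoc_two_mem_liftSet, sStarD_liftSet] at h6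
  nlinarith

/-- **Upper-step dominance in every dimension (any integers `p_d < 6 q_d`) gives the pattern inequalities in every dimension.** [this work] -/
theorem patternPos_of_forall_upperStepDominance (p q : ℕ → ℤ) (hpq : ∀ d, p d < 6 * q d)
    (h : ∀ (d : ℕ) (A B C : Finset (Pd (d + 1))), IsUpperSet (A : Set (Pd (d + 1))) → IsUpperSet (B : Set (Pd (d + 1))) →
      IsUpperSet (C : Set (Pd (d + 1))) →
      (∀ x : Pd d, ind A (Fin.snoc x 1 : Pd (d + 1)) = ind A (Fin.snoc x 2 : Pd (d + 1))) →
      (∀ x : Pd d, ind B (Fin.snoc x 1 : Pd (d + 1)) = ind B (Fin.snoc x 2 : Pd (d + 1))) →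
      (∀ x : Pd d, ind C (Fin.snoc x 1 : Pd (d + 1)) = ind C (Fin.snoc x 2 : Pd (d + 1))) →
      p d * sStarD (univ.filter fun x : Pd d => (Fin.snoc x 2 : Pd (d + 1)) ∈ A)
              (univ.filter fun x : Pd d => (Fin.snoc x 2 : Pd (d + 1)) ∈ B)
              (univ.filter fun x : Pd d => (Fin.snoc x 2 : Pd (d + 1)) ∈ C) ≤ q d * sStarD A B C)
    (d : ℕ) : PatternPos d :=
  patternPos_of_upperStepDominance_succ (hpq d) (h d)

/-- **Upper-step top-slice dominance in every dimension implies Kahn's Conjecture 5.** [this work] -/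
theorem kahnConjecture_of_forall_upperStepDominance (p q : ℕ → ℤ) (hpq : ∀ d, p d < 6 * q d)
    (h : ∀ (d : ℕ) (A B C : Finset (Pd (d + 1))), IsUpperSet (A : Set (Pd (d + 1))) → IsUpperSet (B : Set (Pd (d + 1))) →
      IsUpperSet (C : Set (Pd (d + 1))) →
      (∀ x : Pd d, ind A (Fin.snoc x 1 : Pd (d + 1)) = ind A (Fin.snoc x 2 : Pd (d + 1))) →
      (∀ x : Pd d, ind B (Fin.snoc x 1 : Pd (d + 1)) = ind B (Fin.snoc x 2 : Pd (d + 1))) →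
      (∀ x : Pd d, ind C (Fin.snoc x 1 : Pd (d + 1)) = ind C (Fin.snoc x 2 : Pd (d + 1))) →
      p d * sStarD (univ.filter fun x : Pd d => (Fin.snoc x 2 : Pd (d + 1)) ∈ A)
              (univ.filter fun x : Pd d => (Fin.snoc x 2 : Pd (d + 1)) ∈ B)
              (univ.filter fun x : Pd d => (Fin.snoc x 2 : Pd (d + 1)) ∈ C) ≤ q d * sStarD A B C) :
    KahnConjecture :=
  kahnConjecture_of_forall_patternPos (patternPos_of_forall_upperStepDominance p q hpq h)

/-- **COMB-M⁺ in every dimension implies Kahn's Conjecture 5**: factor-2 top-slice dominance `2·sStarD A₂ B₂ C₂ ≤ sStarD A B C` for all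
UPPER-STEP up-set triples of every `[3]^{d+1}` (cube: `c₂ ≥ c₃` along every axis at every profile). [this work] -/
theorem kahnConjecture_of_forall_combMplus
    (h : ∀ (d : ℕ) (A B C : Finset (Pd (d + 1))), IsUpperSet (A : Set (Pd (d + 1))) → IsUpperSet (B : Set (Pd (d + 1))) →
      IsUpperSet (C : Set (Pd (d + 1))) →
      (∀ x : Pd d, ind A (Fin.snoc x 1 : Pd (d + 1)) = ind A (Fin.snoc x 2 : Pd (d + 1))) →
      (∀ x : Pd d, ind B (Fin.snoc x 1 : Pd (d + 1)) = ind B (Fin.snoc x 2 : Pd (d + 1))) →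
      (∀ x : Pd d, ind C (Fin.snoc x 1 : Pd (d + 1)) = ind C (Fin.snoc x 2 : Pd (d + 1))) →
      2 * sStarD (univ.filter fun x : Pd d => (Fin.snoc x 2 : Pd (d + 1)) ∈ A)
            (univ.filter fun x : Pd d => (Fin.snoc x 2 : Pd (d + 1)) ∈ B)
            (univ.filter fun x : Pd d => (Fin.snoc x 2 : Pd (d + 1)) ∈ C) ≤ 1 * sStarD A B C) :
    KahnConjecture :=
  kahnConjecture_of_forall_upperStepDominance (fun _ => 2) (fun _ => 1) (fun _ => by norm_num) h

/-- **The sharp conjecture (C¼) in every dimension implies Kahn's Conjecture 5**: `7·sStarD A₂ B₂ C₂ ≤ 2·sStarD A B C` for all UPPER-STEP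
up-set triples of every `[3]^{d+1}` (cube: `4c₂ ≥ 7c₃`; tight at `d+1 = 5`). [this work] -/
theorem kahnConjecture_of_forall_sharpCombMplus
    (h : ∀ (d : ℕ) (A B C : Finset (Pd (d + 1))), IsUpperSet (A : Set (Pd (d + 1))) → IsUpperSet (B : Set (Pd (d + 1))) →
      IsUpperSet (C : Set (Pd (d + 1))) →
      (∀ x : Pd d, ind A (Fin.snoc x 1 : Pd (d + 1)) = ind A (Fin.snoc x 2 : Pd (d + 1))) →
      (∀ x : Pd d, ind B (Fin.snoc x 1 : Pd (d + 1)) = ind B (Fin.snoc x 2 : Pd (d + 1))) →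
      (∀ x : Pd d, ind C (Fin.snoc x 1 : Pd (d + 1)) = ind C (Fin.snoc x 2 : Pd (d + 1))) →
      7 * sStarD (univ.filter fun x : Pd d => (Fin.snoc x 2 : Pd (d + 1)) ∈ A)
            (univ.filter fun x : Pd d => (Fin.snoc x 2 : Pd (d + 1)) ∈ B)
            (univ.filter fun x : Pd d => (Fin.snoc x 2 : Pd (d + 1)) ∈ C) ≤ 2 * sStarD A B C) :
    KahnConjecture :=
  kahnConjecture_of_forall_upperStepDominance (fun _ => 7) (fun _ => 2) (fun _ => by norm_num) h

end Summit.CriticalPhenomena.PercolationContinuityZ3.Theorems.SahiGridPattern
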